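import Summits.ABC.StewartYu.YuNinetyW80KappaTransfer
import Summits.ABC.StewartYu.KappaDoorEpsShape
import Literature.Barriers.ABC.BakerMethodBoundsEpsShape
import Literature.Barriers.ABC.BakerMethodBoundsStewartYu1991LineRestrictedProofs
import HarnessLib

/-!
# Cell abc-stewartyu, PATH Z: the two rungs from the WALDSCHMIDT-shape rational-prime estimates —
# `EpsShapeBoundOne` (`rad^{1+ε}`) from the two ODD residue classes, and `stewartYu1991_upperBound`
# (`rad^{2/3+ε}`) from all three (odd classes + `p = 2`)

`Summits/ABC/StewartYu/YuNinetyW80Rungs.lean` — cell `abc-stewartyu` (HOME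
`run/shared/lean/pub/abc-stewartyu/`, seat p3 (g2); theorems only, no definition, no named fact).

This is the conditional rung record for p2-g2's PATH Z (memo-04) + the planner's option (i) "restate the
cruxes of route `PadicPrimesYuNinety` to the Waldschmidt binder": writing
`W80Text a` for "at every prime `p` with `p % 4 = a` (resp. `p = 2`): for `S` a non-empty finite set of
primes `q ≠ p`, `|e_q| ≤ B`, `B ≥ 3`, `∏ q^{e_q} ≠ 1`:
`ord_p(∏ q^{e_q} − 1) < (c₅ #S)^{#S} · p² · (log B + log log A) · log log A · ∏ log max(4,q)`,
`A = max(4, max S)`" (the shape delivered by `YuNinetyW80Transfer.residueClass_of_w80Engine` from a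
Waldschmidt-shape twist engine), we prove

* `epsShapeBoundOne_of_w80Texts_odd` : `W80Text 3 → W80Text 1 → EpsShapeBoundOne` — rung A1.M2⁻
  (`log c ≪_ε rad(abc)^{1+ε}`) through `YuNinetyW80Kappa.finBoundAt_of_residueClasses` and the landed
  odd κ-door `KappaDoor.epsShapeBound_of_oddFinBound` with `(κ,σ,τ,τ₁) = (1,2,1,2)`, `max 1 1 = 1`;
* `stewartYu1991_of_w80Texts` : `W80Text 3 → W80Text 1 → W80Text₂ → stewartYu1991_upperBound` — rung
  A1.M2 (`rad^{2/3+ε}`) through p3's RESTRICTED Stewart–Yu door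
  `Literature.Barriers.ABC.stewartYu1991_of_w80Shape` (merging the three constants as the born route's
  `closes` does). This is the `closes` of a PATH-Z restatement of route `PadicPrimesYuNinety`.

Everything is [folklore] composition. WHAT THIS IS NOT: no `p`-adic estimate is proved here; the three
Waldschmidt-shape texts are hypotheses (the engines are the XL stubs); the texts are not yet route decls.
-/

noncomputable section

open Finset Real

namespace Summit.ABC.StewartYu

namespace YuNinetyW80Rungs

open KappaDoor Literature.Barriers.ABC

/-- **Rung A1.M2⁻ from the two odd Waldschmidt-shape texts**: `EpsShapeBoundOne`. [folklore] -/
theorem epsShapeBoundOne_of_w80Texts_odd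
    (h₃ : ∃ c₅ : ℝ, ∀ (p : ℕ), p.Prime → p % 4 = 3 → ∀ (S : Finset ℕ), (∀ q ∈ S, q.Prime) → p ∉ S →
      S.Nonempty → ∀ (e : ℕ → ℤ) (B : ℝ), 3 ≤ B → (∀ q ∈ S, (|e q| : ℝ) ≤ B) →
      ∏ q ∈ S, (q : ℚ) ^ e q ≠ 1 →
      (padicValRat p (∏ q ∈ S, (q : ℚ) ^ e q - 1) : ℝ) <
        (c₅ * S.card) ^ S.card * (p : ℝ) ^ 2 *
          ((Real.log B + Real.log (Real.log ((max 4 (S.sup id) : ℕ) : ℝ))) *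
            Real.log (Real.log ((max 4 (S.sup id) : ℕ) : ℝ))) * ∏ q ∈ S, Real.log ((max 4 q : ℕ) : ℝ))
    (h₁ : ∃ c₅ : ℝ, ∀ (p : ℕ), p.Prime → p % 4 = 1 → ∀ (S : Finset ℕ), (∀ q ∈ S, q.Prime) → p ∉ S →
      S.Nonempty → ∀ (e : ℕ → ℤ) (B : ℝ), 3 ≤ B → (∀ q ∈ S, (|e q| : ℝ) ≤ B) →
      ∏ q ∈ S, (q : ℚ) ^ e q ≠ 1 →
      (padicValRat p (∏ q ∈ S, (q : ℚ) ^ e q - 1) : ℝ) <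
        (c₅ * S.card) ^ S.card * (p : ℝ) ^ 2 *
          ((Real.log B + Real.log (Real.log ((max 4 (S.sup id) : ℕ) : ℝ))) *
            Real.log (Real.log ((max 4 (S.sup id) : ℕ) : ℝ))) * ∏ q ∈ S, Real.log ((max 4 q : ℕ) : ℝ)) :
    Literature.Barriers.ABC.EpsShapeBoundOne := by
  obtain ⟨c₅, h₃⟩ := h₃
  obtain ⟨c₅', h₁⟩ := h₁
  have hL : (1 : ℝ) ≤ 2 * max 1 (max |c₅| |c₅'|) := by
    have : (1 : ℝ) ≤ max 1 (max |c₅| |c₅'|) := le_max_left _ _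
    linarith
  have h := epsShapeBound_of_oddFinBound (K := 8) (L := 2 * max 1 (max |c₅| |c₅'|)) (κ := 1)
    (σ := 2) (τ := 1) (τ₁ := 2) (by norm_num) hL zero_le_two le_rfl
    (fun p hp hp2 => YuNinetyW80Kappa.finBoundAt_of_residueClasses h₃ h₁ hp hp2)
  rw [max_self] at h
  exact h

/-- **Rung A1.M2 from the three Waldschmidt-shape texts** (`p ≡ 3`, `p ≡ 1 (mod 4)`, `p = 2`):
`stewartYu1991_upperBound`, by the restricted Stewart–Yu door `stewartYu1991_of_w80Shape` with the
merged constant `max(|c₃|, |c₁|, |c₂|)` (the tail of the bound is non-negative, so constants may be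
enlarged — verbatim the merging of the born route's `closes`). [folklore] -/
theorem stewartYu1991_of_w80Texts
    (h₃ : ∃ c₅ : ℝ, ∀ (p : ℕ), p.Prime → p % 4 = 3 → ∀ (S : Finset ℕ), (∀ q ∈ S, q.Prime) → p ∉ S →
      S.Nonempty → ∀ (e : ℕ → ℤ) (B : ℝ), 3 ≤ B → (∀ q ∈ S, (|e q| : ℝ) ≤ B) →
      ∏ q ∈ S, (q : ℚ) ^ e q ≠ 1 →
      (padicValRat p (∏ q ∈ S, (q : ℚ) ^ e q - 1) : ℝ) <
        (c₅ * S.card) ^ S.card * (p : ℝ) ^ 2 *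
          ((Real.log B + Real.log (Real.log ((max 4 (S.sup id) : ℕ) : ℝ))) *
            Real.log (Real.log ((max 4 (S.sup id) : ℕ) : ℝ))) * ∏ q ∈ S, Real.log ((max 4 q : ℕ) : ℝ))
    (h₁ : ∃ c₅ : ℝ, ∀ (p : ℕ), p.Prime → p % 4 = 1 → ∀ (S : Finset ℕ), (∀ q ∈ S, q.Prime) → p ∉ S →
      S.Nonempty → ∀ (e : ℕ → ℤ) (B : ℝ), 3 ≤ B → (∀ q ∈ S, (|e q| : ℝ) ≤ B) →
      ∏ q ∈ S, (q : ℚ) ^ e q ≠ 1 →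
      (padicValRat p (∏ q ∈ S, (q : ℚ) ^ e q - 1) : ℝ) <
        (c₅ * S.card) ^ S.card * (p : ℝ) ^ 2 *
          ((Real.log B + Real.log (Real.log ((max 4 (S.sup id) : ℕ) : ℝ))) *
            Real.log (Real.log ((max 4 (S.sup id) : ℕ) : ℝ))) * ∏ q ∈ S, Real.log ((max 4 q : ℕ) : ℝ))
    (h₂ : ∃ c₅ : ℝ, ∀ (S : Finset ℕ), (∀ q ∈ S, q.Prime) → 2 ∉ S →
      S.Nonempty → ∀ (e : ℕ → ℤ) (B : ℝ), 3 ≤ B → (∀ q ∈ S, (|e q| : ℝ) ≤ B) →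
      ∏ q ∈ S, (q : ℚ) ^ e q ≠ 1 →
      (padicValRat 2 (∏ q ∈ S, (q : ℚ) ^ e q - 1) : ℝ) <
        (c₅ * S.card) ^ S.card * (2 : ℝ) ^ 2 *
          ((Real.log B + Real.log (Real.log ((max 4 (S.sup id) : ℕ) : ℝ))) *
            Real.log (Real.log ((max 4 (S.sup id) : ℕ) : ℝ))) * ∏ q ∈ S, Real.log ((max 4 q : ℕ) : ℝ)) :
    Literature.Barriers.ABC.stewartYu1991_upperBound := by
  obtain ⟨c₃, H₃⟩ := h₃
  obtain ⟨c₁, H₁⟩ := h₁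
  obtain ⟨c₂, H₂⟩ := h₂
  refine Literature.Barriers.ABC.stewartYu1991_of_w80Shape (max (max |c₃| |c₁|) |c₂|) ?_
  intro p hp S hS hpS hne e B hB heB hne1
  -- the tail of the bound is non-negative, so the constant may be enlarged
  have h4 : (4 : ℝ) ≤ ((max 4 (S.sup id) : ℕ) : ℝ) := by exact_mod_cast le_max_left _ _
  have hlog4 : (1 : ℝ) ≤ Real.log ((max 4 (S.sup id) : ℕ) : ℝ) := by
    have he : Real.exp 1 ≤ 4 := by have := Real.exp_one_lt_d9; linarith
    calc (1 : ℝ) = Real.log (Real.exp 1) := (Real.log_exp 1).symm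
      _ ≤ Real.log 4 := Real.log_le_log (Real.exp_pos 1) he
      _ ≤ _ := Real.log_le_log (by norm_num) h4
  have hT : 0 ≤ (p : ℝ) ^ 2 * ((Real.log B + Real.log (Real.log ((max 4 (S.sup id) : ℕ) : ℝ))) *
      Real.log (Real.log ((max 4 (S.sup id) : ℕ) : ℝ))) * ∏ q ∈ S, Real.log ((max 4 q : ℕ) : ℝ) := by
    have hB' : 0 ≤ Real.log B := Real.log_nonneg (by linarith)
    have hLL : 0 ≤ Real.log (Real.log ((max 4 (S.sup id) : ℕ) : ℝ)) := Real.log_nonneg hlog4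
    have hP : 0 ≤ ∏ q ∈ S, Real.log ((max 4 q : ℕ) : ℝ) :=
      Finset.prod_nonneg fun q _ => Real.log_nonneg (by exact_mod_cast le_max_of_le_left (by norm_num))
    positivity
  have mono : ∀ c : ℝ, |c| ≤ max (max |c₃| |c₁|) |c₂| → ∀ v : ℝ,
      v < (c * S.card) ^ S.card * (p : ℝ) ^ 2 *
          ((Real.log B + Real.log (Real.log ((max 4 (S.sup id) : ℕ) : ℝ))) *
            Real.log (Real.log ((max 4 (S.sup id) : ℕ) : ℝ))) * ∏ q ∈ S, Real.log ((max 4 q : ℕ) : ℝ) →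
      v < (max (max |c₃| |c₁|) |c₂| * S.card) ^ S.card * (p : ℝ) ^ 2 *
          ((Real.log B + Real.log (Real.log ((max 4 (S.sup id) : ℕ) : ℝ))) *
            Real.log (Real.log ((max 4 (S.sup id) : ℕ) : ℝ))) * ∏ q ∈ S, Real.log ((max 4 q : ℕ) : ℝ) := by
    intro c hc v hv
    have hpow : (c * S.card) ^ S.card ≤ (max (max |c₃| |c₁|) |c₂| * S.card) ^ S.card := by
      calc (c * S.card) ^ S.card ≤ |(c * S.card) ^ S.card| := le_abs_self _
        _ = (|c| * S.card) ^ S.card := by rw [abs_pow, abs_mul, Nat.abs_cast]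
        _ ≤ _ := pow_le_pow_left₀ (by positivity)
              (mul_le_mul_of_nonneg_right hc (Nat.cast_nonneg _)) _
    refine lt_of_lt_of_le hv ?_
    have := mul_le_mul_of_nonneg_right hpow hT
    calc (c * S.card) ^ S.card * (p : ℝ) ^ 2 *
          ((Real.log B + Real.log (Real.log ((max 4 (S.sup id) : ℕ) : ℝ))) *
            Real.log (Real.log ((max 4 (S.sup id) : ℕ) : ℝ))) * ∏ q ∈ S, Real.log ((max 4 q : ℕ) : ℝ)
        = (c * S.card) ^ S.card * ((p : ℝ) ^ 2 *
          ((Real.log B + Real.log (Real.log ((max 4 (S.sup id) : ℕ) : ℝ))) *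
            Real.log (Real.log ((max 4 (S.sup id) : ℕ) : ℝ))) * ∏ q ∈ S, Real.log ((max 4 q : ℕ) : ℝ)) := by
          ring
      _ ≤ (max (max |c₃| |c₁|) |c₂| * S.card) ^ S.card * ((p : ℝ) ^ 2 *
          ((Real.log B + Real.log (Real.log ((max 4 (S.sup id) : ℕ) : ℝ))) *
            Real.log (Real.log ((max 4 (S.sup id) : ℕ) : ℝ))) * ∏ q ∈ S, Real.log ((max 4 q : ℕ) : ℝ)) :=
          this
      _ = _ := by ring
  rcases hp.eq_two_or_odd with hp2 | hodd
  · subst hp2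
    have h := H₂ S hS hpS hne e B hB heB hne1
    refine mono c₂ (le_max_right _ _) _ ?_
    simpa only [Nat.cast_ofNat] using h
  · have h13 : p % 4 = 1 ∨ p % 4 = 3 := by omega
    rcases h13 with h1 | h3
    · exact mono c₁ ((le_max_right _ _).trans (le_max_left _ _)) _
        (H₁ p hp h1 S hS hpS hne e B hB heB hne1)
    · exact mono c₃ ((le_max_left _ _).trans (le_max_left _ _)) _
        (H₃ p hp h3 S hS hpS hne e B hB heB hne1)

end YuNinetyW80Rungs

end Summit.ABC.StewartYu

end
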